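import Summits.Schanuel.Schanuel.Theorems.RootDecomp1KLevelFinite10

/-!
# RootDecomp1KLevelFinite — lens 1, generation 51 ADDENDUM-3 «THE 2-ADICALLY ROOTLESS TOP CLASS + RESIDUAL MOVED SiegelShapes → SiegelShapesOff(At m₀)» (RECORD port, ×0) — continuation (RootDecomp1KLevelFinite11): §10.4–§10.7 members, position, the residual of record moved (SiegelShapesOff / SiegelShapesOffAt)

(lens-1 g51 ADDENDUM-3 kernel K⁗ = HOME/decomp-schanuel-lens-1/g51/LevelFiniteRootless.lean 5ccaaffb…, 628 l, 42 thm + 9 def, imports tree …RootDecomp1KLevelFinite09 + …RootDecomp1KXAll03 ONLY; P⁗ b2845109… rc 0 / C0⁗ db3584fd… rc 0 / C⁗ c4042d8e… rc 1 = 13 planted; ADDENDUM-3/NODE L2508 / REQUEST L2509, writer re-check L2510, critic VERDICT L2511: NOT CLEARED for credit (×0 under RULE K-R36 (i), threshold lane closed) — the RESIDUAL RE-BOOKING ACCEPTED AS RECORD and a RECORD PORT recommended; RULE K-R40 (viii) (open territory of record) fixed. RECORD port by census-1 gen 21 as `RootDecomp1KLevelFinite10–11` (×0, no credit anywhere): 10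 = §10.1–§10.3 the 2-ADICALLY ROOTLESS TOP CLASS — `rootless_lower_bound` (a polynomial with no root in ℚ₂ is bounded below on ℚ₂), `thinFibreAt_xPolyP_of_rootless`, the typed class `RootlessTop e` with `thinFibreAt_of_rootlessTop` / `levelFinite_of_rootlessTop`; 11 = §10.4 members (ω ∉ ℚ₂; the superelliptic curves W^k = Y^(2k−1) − 2 in the coordinate x = W/(Y²+Y+1): `superP`, `thinFibreAt_two_ellipticMember`, `quinticP`), §10.5 position (`not_xLinearLt_superP_two`, `not_separable_top_superP_two`), §10.6 THE RESIDUAL OF RECORD MOVED: `SiegelClause P` ([statement def with parameter] = the four disjuncts of `SiegelShapes` per curve, `siegelShapes_iff_clause`), `SiegelShapesOff` (residual hypothesis: Siegel's clause only OFF the tree-decided classes; NOT proved; sources as in `SiegelShapes`), `siegelShapesOff_of_siegelShapes`, `thinFibre_of_siegelShapesOff`, and §10.7 per quality: `DecidedAt m₀ P` (five disjuncts, each discharged BY TREE NAME), `SiegelShapesOffAt m₀`, **`thinFibre_of_siegelShapesOffAt`**, (b) / SB 2 / 31077-pair corollaries. PORT EDITS: none beyond the census module docstring (K has no set_option, no private,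 no undocumented decl, no «[cite» token); statements and proofs verbatim. `--supports stmt-Schanuel-33364`; rung 0 — nothing here proves Schanuel, 33364, 31077, SiegelShapes(Off) or ThinFibre m₀ hypothesis-free.)
-/

noncomputable section

open Polynomial LiouvilleNumber
open scoped Nat
namespace Summit.Schanuel.Schanuel.Theorems.RootDecomp1KLevelFinite

open Summit.Schanuel.Schanuel.Theorems.RootDecomp1KSkelCell (SkelLiouvilleFix)
open Summit.Schanuel.Schanuel.Theorems.RootDecomp1KTwoBaseCell (psNumer sb_of_range_eq')
open Summit.Schanuel.Schanuel.Theorems.RootDecomp1KRelLiouvilleCell (partialSum_two_lt_liouvilleNumber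
  liouvilleNumber_two_lt partialSum_two_zero)
open Summit.Schanuel.Schanuel.Theorems.RootDecomp1KDegreeLadder
open Summit.Schanuel.Schanuel.Theorems.RootDecomp1KXLinear (xLinP bev_xLinP aeval_ratCast XLinearLt
  thinFibreAt_of_xLinearLt)
open Summit.Schanuel.Schanuel.Theorems.RootDecomp1KXLinearII (thinFibreAt_xLinear_of_sep)
open Summit.Schanuel.Schanuel.Theorems.RootDecomp1KXTop (xPolyP bev_xPolyP top_coeff_small infinity_arith
  norm_ratCast_le_den)
open Summit.Schanuel.Schanuel.Theorems.RootDecomp1KXAll (thinThreshold thinFibreAt_all)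
open Summit.Schanuel.Schanuel.Theorems.RootDecomp1KHyper (SB)

section RootlessTop

/-! ### §10.4  Members: `ω ∉ ℚ₂`, and the superelliptic curves `W^k = Y^{2k−1} − 2` in the coordinate `x = W/(Y²+Y+1)` -/

/-- **`Y² + Y + 1` has no root in `ℚ₂`** (`ω ∉ ℚ₂`): a root of norm `> 1` is impossible ultrametrically
(`‖z‖² = ‖z + 1‖ ≤ ‖z‖`), a root in `ℤ₂` is impossible modulo `2` (`t² + t + 1 = 1` in `𝔽₂`). -/
theorem rootless_cyc3 : ∀ z : ℚ_[2], aeval z (X ^ 2 + X + 1 : ℤ[X]) ≠ 0 := by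
  intro z hz
  have e : aeval z (X ^ 2 + X + 1 : ℤ[X]) = z ^ 2 + z + 1 := by simp
  rw [e] at hz
  by_cases h1 : ‖z‖ ≤ 1
  · set zI : ℤ_[2] := ⟨z, h1⟩ with hzI
    have hI : zI ^ 2 + zI + 1 = 0 := by
      have : ((zI ^ 2 + zI + 1 : ℤ_[2]) : ℚ_[2]) = 0 := by push_cast; exact hz
      exact PadicInt.ext (by rw [this, PadicInt.coe_zero])
    have hmod := congrArg (PadicInt.toZMod (p := 2)) hI
    rw [map_add, map_add, map_pow, map_one, map_zero] at hmod
    generalize PadicInt.toZMod (p := 2) zI = t at hmod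
    revert t hmod
    decide
  · rw [not_le] at h1
    have hz2 : z ^ 2 = -(z + 1) := by linear_combination hz
    have hn : ‖z‖ ^ 2 ≤ max ‖z‖ ‖(1 : ℚ_[2])‖ := by
      rw [← norm_pow, hz2, norm_neg]
      exact Padic.nonarchimedean z 1
    rw [norm_one, max_eq_left h1.le] at hn
    nlinarith [norm_nonneg z]

/-- powers of a rootless polynomial are rootless. -/
theorem rootless_pow {f : ℤ[X]} (hf : ∀ z : ℚ_[2], aeval z f ≠ 0) (n : ℕ) :
    ∀ z : ℚ_[2], aeval z (f ^ n) ≠ 0 := by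
  intro z
  rw [map_pow]
  exact pow_ne_zero _ (hf z)

/-- the `x`-coefficients of the superelliptic member of `x`-degree `k`:
`c_k = (Y² + Y + 1)^k`, `c_0 = −(Y^{2k−1} + 2)`, all others `0`. -/
def superC (k : ℕ) : ℕ → ℤ[X] := fun j =>
  if j = k then (X ^ 2 + X + 1) ^ k else if j = 0 then -(X ^ (2 * k - 1) + C 2) else 0

/-- **the superelliptic member** `superP k = x^k·(Y² + Y + 1)^k − (Y^{2k−1} + 2) ∈ ℤ[x][Y]`: the curve
`W^k = Y^{2k−1} + 2` (genus `(k−1)²`; `≥ 1` for `k ≥ 2`) in the coordinate `x = W/(Y² + Y + 1)`;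
`k = 2`: the elliptic curve `W² = Y³ + 2` (a Mordell curve with infinitely many rational points: `(−1, ±1)`,
`(17/4, ±71/8) = ∓2·(−1, ±1)`, …) as `x²(Y²+Y+1)² = Y³ + 2`; its fibre over `x = ℓ₂` has a real point
(`exists_real_fibre_point_superP_two`). -/
def superP (k : ℕ) : ℤ[X][X] := xPolyP k (superC k)

/-- `(X ^ 2 + X + 1 : ℤ[X]).natDegree = 2`. -/
theorem natDegree_cyc3 : (X ^ 2 + X + 1 : ℤ[X]).natDegree = 2 := by compute_degree!

/-- `(k : ℕ) : superC k k = (X ^ 2 + X + 1) ^ k`. -/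
theorem superC_top (k : ℕ) : superC k k = (X ^ 2 + X + 1) ^ k := by simp [superC]

/-- `{k : ℕ} (hk : 1 ≤ k) : superC k 0 = -(X ^ (2 * k - 1) + C 2)`. -/
theorem superC_zero {k : ℕ} (hk : 1 ≤ k) : superC k 0 = -(X ^ (2 * k - 1) + C 2) := by
  have h : (0 : ℕ) ≠ k := by omega
  simp [superC, h]

/-- `{k j : ℕ} (hj0 : j ≠ 0) (hjk : j ≠ k) : superC k j = 0`. -/
theorem superC_mid {k j : ℕ} (hj0 : j ≠ 0) (hjk : j ≠ k) : superC k j = 0 := by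
  simp [superC, hj0, hjk]

/-- **every superelliptic member lies in the class `RootlessTop`** (`k ≥ 1`). -/
theorem rootlessTop_superP {k : ℕ} (hk : 1 ≤ k) : RootlessTop 0 (superP k) := by
  refine ⟨k, superC k, fun j hj => ?_, ?_, rfl⟩
  · rw [superC_top, natDegree_pow, natDegree_cyc3, add_zero]
    by_cases hj0 : j = 0
    · subst hj0
      rw [superC_zero hk, natDegree_neg, natDegree_X_pow_add_C]
      omega
    · rw [superC_mid hj0 (by omega)]
      simp
  · rw [superC_top]
    exact rootless_pow rootless_cyc3 k

/-- **LEVEL FINITENESS OF EVERY SUPERELLIPTIC MEMBER `x^k(Y²+Y+1)^k = Y^{2k−1} + 2`, `k ≥ 1` — hypothesis-free.** -/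
theorem levelFinite_superP {k : ℕ} (hk : 1 ≤ k) : LevelFinite (superP k) :=
  levelFinite_of_rootlessTop (rootlessTop_superP hk)

/-- … and its thin-fibre clause at EVERY quality `m₀` (in particular `m₀ = 2, 3, 4` for the elliptic member
`k = 2`, below every threshold the tree attaches to it). -/
theorem thinFibreAt_superP {k : ℕ} (hk : 1 ≤ k) (m₀ : ℕ) : ThinFibreAt m₀ (superP k) :=
  thinFibreAt_of_rootlessTop_zero (rootlessTop_superP hk) m₀

/-- the elliptic member: `ThinFibreAt 2 (x²(Y²+Y+1)² − (Y³ + 2))`. -/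
theorem thinFibreAt_two_ellipticMember : ThinFibreAt 2 (superP 2) :=
  thinFibreAt_superP (by norm_num) 2

/-- `bev` of the superelliptic member: `bev (superP k) x y = x^k (y²+y+1)^k − (y^{2k−1} + 2)` (`k ≥ 1`). -/
theorem bev_superP {k : ℕ} (hk : 1 ≤ k) (x y : ℝ) :
    bev (superP k) x y = x ^ k * (y ^ 2 + y + 1) ^ k - (y ^ (2 * k - 1) + 2) := by
  unfold superP
  rw [bev_xPolyP, Finset.sum_range_succ, superC_top,
    Finset.sum_eq_single_of_mem 0 (Finset.mem_range.mpr (by omega))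
      (fun j hj hj0 => by
        rw [superC_mid hj0 (by have := Finset.mem_range.mp hj; omega)]
        simp),
    superC_zero hk]
  simp only [pow_zero, one_mul, map_neg, map_pow, aeval_X, map_ofNat, map_add, map_one]
  ring

/-- the `x`-coefficients of the genus-2 member of order `e = 1`: `c_2 = Y² + Y + 1`, `c_0 = −(Y³ + 2)`. -/
def quinticC : ℕ → ℤ[X] := fun j =>
  if j = 2 then X ^ 2 + X + 1 else if j = 0 then -(X ^ 3 + C 2) else 0

/-- **the genus-2 member** `quinticP = x²(Y² + Y + 1) − (Y³ + 2)`: the hyperelliptic curve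
`W² = (Y³ + 2)(Y² + Y + 1)` in the coordinate `x = W/(Y² + Y + 1)`; order `e = 1` at `(∞, ∞)`. -/
def quinticP : ℤ[X][X] := xPolyP 2 quinticC

/-- `quinticP ∈ RootlessTop 1`. -/
theorem rootlessTop_quinticP : RootlessTop 1 quinticP := by
  refine ⟨2, quinticC, fun j hj => ?_, ?_, rfl⟩
  · have h2 : quinticC 2 = X ^ 2 + X + 1 := by simp [quinticC]
    rw [h2, natDegree_cyc3]
    interval_cases j
    · have h0 : quinticC 0 = -(X ^ 3 + C 2) := by simp [quinticC]
      rw [h0, natDegree_neg, natDegree_X_pow_add_C]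
    · have h1 : quinticC 1 = 0 := by simp [quinticC]
      rw [h1]
      simp
  · have h2 : quinticC 2 = X ^ 2 + X + 1 := by simp [quinticC]
    rw [h2]
    exact rootless_cyc3

/-- **THE THIN-FIBRE CLAUSE OF THE GENUS-2 MEMBER `x²(Y²+Y+1) = Y³ + 2` AT EVERY `m₀ ≥ 2` — hypothesis-free.** -/
theorem thinFibreAt_quinticP {m₀ : ℕ} (hm : 2 ≤ m₀) : ThinFibreAt m₀ quinticP :=
  thinFibreAt_of_rootlessTop rootlessTop_quinticP hm

/-- `bev quinticP x y = x² (y²+y+1) − (y³ + 2)`. -/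
theorem bev_quinticP (x y : ℝ) : bev quinticP x y = x ^ 2 * (y ^ 2 + y + 1) - (y ^ 3 + 2) := by
  unfold quinticP
  rw [bev_xPolyP, Finset.sum_range_succ, Finset.sum_range_succ, Finset.sum_range_one]
  have h0 : quinticC 0 = -(X ^ 3 + C 2) := by simp [quinticC]
  have h1 : quinticC 1 = 0 := by simp [quinticC]
  have h2 : quinticC 2 = X ^ 2 + X + 1 := by simp [quinticC]
  rw [h0, h1, h2]
  simp only [pow_zero, one_mul, map_neg, map_add, map_pow, aeval_X, map_ofNat, map_one, map_zero, mul_zero,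
    add_zero, pow_one]
  ring

/-! ### §10.5  Position: the elliptic member is not x-linear -/

/-- **`superP 2 = x²(Y²+Y+1)² − (Y³ − 2)` is NOT in the tree's class `XLinearLt`** (indeed not of the form
`A(Y) + x·B(Y)` at all: `x ↦ P(x, 0) = x² + 2` is not affine). -/
theorem not_xLinearLt_superP_two : ¬ XLinearLt (superP 2) := by
  rintro ⟨A, B, -, -, hP⟩
  have h := fun x : ℝ => congrArg (fun Q => bev Q x 0) hP
  simp only [bev_superP (by norm_num : 1 ≤ 2), bev_xLinP] at h
  have h0 := h 0
  have h1 := h 1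
  have h2 := h 2
  norm_num at h0 h1 h2
  linarith

/-- the top `x`-coefficient `(Y²+Y+1)²` of the elliptic member is NOT separable (double roots `ω, ω̄`: `μ = 2`), so
the tree's separable-top theorems (`RootDecomp1KXTop.thinFibreAt_xTop`, `…XAll`'s `μ ≤ 1` cases) do not apply to it,
and its threshold `thinThreshold = max(3, 2μ+1, e+1)` is `5`. -/
theorem not_separable_top_superP_two : ¬ ((superC 2 2).map (Int.castRingHom ℚ)).Separable := by
  rw [superC_top, Polynomial.map_pow]
  intro h
  have hq : ¬ IsUnit ((X ^ 2 + X + 1 : ℤ[X]).map (Int.castRingHom ℚ)) := by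
    intro hu
    have h0 := natDegree_eq_zero_of_isUnit hu
    have h2 : ((X ^ 2 + X + 1 : ℤ[X]).map (Int.castRingHom ℚ)).natDegree = 2 := by
      rw [Polynomial.map_add, Polynomial.map_add, Polynomial.map_pow, map_X, Polynomial.map_one]
      compute_degree!
    omega
  exact hq (h.squarefree _ ⟨1, by ring⟩)

/-- the fibre of the elliptic member over `x = ℓ₂` HAS a real point (`P(ℓ₂, −1) = ℓ₂² − 1 > 0 > P(ℓ₂, −1/2)` since
`1 < ℓ₂ < 3/2`): its thin-fibre clause is not vacuous for archimedean reasons. -/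
theorem exists_real_fibre_point_superP_two : ∃ y : ℝ, bev (superP 2) (liouvilleNumber 2) y = 0 := by
  have h1 : 1 < liouvilleNumber 2 := by
    have h := partialSum_two_lt_liouvilleNumber 1
    have e : partialSum 2 1 = 1 := by
      rw [partialSum_succ, partialSum_two_zero]
      norm_num
    linarith
  have h2 : liouvilleNumber 2 < 3 / 2 := liouvilleNumber_two_lt
  set ℓ : ℝ := liouvilleNumber 2 with hℓ
  let f : ℝ → ℝ := fun y => ℓ ^ 2 * (y ^ 2 + y + 1) ^ 2 - (y ^ (2 * 2 - 1) + 2)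
  have hf : ContinuousOn f (Set.Icc (-1) (-1 / 2)) := by
    apply Continuous.continuousOn
    fun_prop
  have ha : 0 < f (-1) := by
    show 0 < ℓ ^ 2 * ((-1) ^ 2 + (-1) + 1) ^ 2 - ((-1) ^ (2 * 2 - 1) + 2)
    norm_num
    rw [abs_of_pos (by linarith)]
    exact h1
  have hb : f (-1 / 2) < 0 := by
    show ℓ ^ 2 * ((-1 / 2) ^ 2 + (-1 / 2) + 1) ^ 2 - ((-1 / 2) ^ (2 * 2 - 1) + 2) < 0
    norm_num
    nlinarith
  obtain ⟨y, -, hy⟩ := intermediate_value_Icc' (show (-1 : ℝ) ≤ -1 / 2 by norm_num) hf ⟨hb.le, ha.le⟩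
  exact ⟨y, by rw [bev_superP (by norm_num)]; exact hy⟩

/-- two of the (infinitely many) rational points of the elliptic member: `(x, Y) = (1, −1)` and `(142/373, 17/4)`
(i.e. `(Y, W) = (−1, 1)` and `(17/4, 71/8)` on `W² = Y³ + 2`). -/
theorem ratPoints_superP_two :
    bev (superP 2) 1 (-1) = 0 ∧ bev (superP 2) ((142 / 373 : ℚ) : ℝ) ((17 / 4 : ℚ) : ℝ) = 0 := by
  constructor <;> (rw [bev_superP (by norm_num)]; push_cast; norm_num)

/-- **`quinticP = x²(Y²+Y+1) − (Y³ + 2)` is NOT in `XLinearLt`** (`x ↦ P(x, 0) = x² − 2` is not affine). -/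
theorem not_xLinearLt_quinticP : ¬ XLinearLt quinticP := by
  rintro ⟨A, B, -, -, hP⟩
  have h := fun x : ℝ => congrArg (fun Q => bev Q x 0) hP
  simp only [bev_quinticP, bev_xLinP] at h
  have h0 := h 0
  have h1 := h 1
  have h2 := h 2
  norm_num at h0 h1 h2
  linarith

/-! ### §10.6  THE RESIDUAL OF RECORD MOVED: Siegel's branch only OFF the tree-decided classes -/

/-- [statement def with parameter] **Siegel's clause for ONE curve `P`**: the four disjuncts of `SiegelShapes`
((A) finitely many dyadic `x`-coordinates of rational points ∨ (B1) one-pole shape ∨ (B2a) two-rational-poles shape ∨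
(B2b) conjugate-poles shape), verbatim. -/
def SiegelClause (P : ℤ[X][X]) : Prop :=
  (Set.Finite {x : ℚ | IsDyadic x ∧ ∃ r : ℚ, bev P x r = 0}) ∨
    (∃ (f : ℤ[X]) (D : ℤ) (E : Finset ℚ), 2 ≤ f.natDegree ∧ D ≠ 0 ∧
        ∀ x r : ℚ, bev P x r = 0 → x ∈ E ∨ ∃ t : ℚ, aeval t f = D * x) ∨
    (∃ (g : ℤ[X]) (a : ℕ) (D : ℤ) (E : Finset ℚ), 1 ≤ a ∧ a < g.natDegree ∧ g.coeff 0 ≠ 0 ∧ D ≠ 0 ∧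
        ∀ x r : ℚ, bev P x r = 0 → x ∈ E ∨ ∃ t : ℚ, t ≠ 0 ∧ aeval t g = D * x * t ^ a) ∨
    (∃ (g q : ℤ[X]) (a : ℕ) (D : ℤ) (E : Finset ℚ), NormShapeHyp g q a D ∧
        ∀ x r : ℚ, bev P x r = 0 → x ∈ E ∨ ∃ t : ℚ, aeval t g = D * x * (aeval t q) ^ a)

/-- `SiegelShapes` IS the clause for every prime of `Y`-degree `≥ 2` (by `rfl`). -/
theorem siegelShapes_iff_clause :
    SiegelShapes ↔ ∀ P : ℤ[X][X], Prime P → 2 ≤ P.natDegree → SiegelClause P := Iff.rfl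

/-- **Siegel's clause for `P` gives LEVEL FINITENESS of `P` — every exceptional shape being PROVED in the tree**
(`polyShapeLF`, `laurentShapeLF_holds`, `normShapeLevels_finite`). -/
theorem levelFinite_of_siegelClause {P : ℤ[X][X]} (h : SiegelClause P) : LevelFinite P := by
  intro C₀
  have key : ∀ N ∈ LevelSet P C₀, ∃ r : ℚ, bev P (sQ N) r = 0 := by
    rintro N ⟨r, -, h, -⟩
    exact ⟨r, by rwa [sQ_cast]⟩
  rcases h with hA | ⟨f, D, E, hf, hD, hB⟩ | ⟨g, a, D, E, ha, hag, hg0, hD, hB⟩ | ⟨g, q, a, D, E, hH, hB⟩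
  · refine (finite_levels_of_finite hA).subset fun N hN => ?_
    obtain ⟨r, hr⟩ := key N hN
    exact ⟨isDyadic_sQ N, r, hr⟩
  · refine ((finite_levels_of_finite E.finite_toSet).union (polyShapeLF f hf D hD)).subset fun N hN => ?_
    obtain ⟨r, hr⟩ := key N hN
    rcases hB _ _ hr with h | ⟨t, ht⟩
    · exact Or.inl h
    · exact Or.inr ⟨t, ht⟩
  · refine ((finite_levels_of_finite E.finite_toSet).union
      (laurentShapeLF_holds g a D ha hag hg0 hD)).subset fun N hN => ?_
    obtain ⟨r, hr⟩ := key N hN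
    rcases hB _ _ hr with h | ⟨t, ht0, ht⟩
    · exact Or.inl h
    · exact Or.inr ⟨t, ht0, ht⟩
  · refine ((finite_levels_of_finite E.finite_toSet).union
      (normShapeLevels_finite g q a D hH)).subset fun N hN => ?_
    obtain ⟨r, hr⟩ := key N hN
    rcases hB _ _ hr with h | ⟨t, ht⟩
    · exact Or.inl h
    · exact Or.inr ⟨t, ht⟩

/-- [residual statement def — NOT proved; census convention] **SIEGEL'S SHAPES OFF THE TREE-DECIDED CLASSES**:
Siegel's clause demanded only for primes `P` of `Y`-degree `≥ 2` lying OUTSIDE the two classes on which the thin-fibre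
clause is decided hypothesis-free in the tree — node 2's `XLinearLt` (`x = −A(Y)/B(Y)`, `deg B < deg A`; Ridout) and
this node's `RootlessTop 1` (`⊇ RootlessTop 0`; valuations only).  Strictly fewer instances of Siegel's theorem than `SiegelShapes`
(`siegelShapesOff_of_siegelShapes`). -/
def SiegelShapesOff : Prop :=
  ∀ P : ℤ[X][X], Prime P → 2 ≤ P.natDegree → ¬ XLinearLt P → ¬ RootlessTop 1 P → SiegelClause P

/-- **the weakening, PROVED**: `SiegelShapes → SiegelShapesOff`. -/
theorem siegelShapesOff_of_siegelShapes (hS : SiegelShapes) : SiegelShapesOff :=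
  fun P hP hd _ _ => hS P hP hd

/-- **THE THIN-FIBRE CLAUSE FOR EVERY PRIME OF `Y`-DEGREE `≥ 2`, at every `m₀ ≥ 2`, FROM `SiegelShapesOff`**:
on `XLinearLt` by `thinFibreAt_of_xLinearLt` (tree, node 2), on `RootlessTop 1` by `thinFibreAt_of_rootlessTop` (§10.3),
elsewhere by Siegel's clause and the proved shapes. -/
theorem thinFibreAt_prime_of_siegelShapesOff (hS : SiegelShapesOff) {m₀ : ℕ} (hm : 2 ≤ m₀) (P : ℤ[X][X])
    (hP : Prime P) (hd : 2 ≤ P.natDegree) : ThinFibreAt m₀ P := by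
  by_cases h1 : XLinearLt P
  · exact thinFibreAt_of_xLinearLt h1 hm
  by_cases h2 : RootlessTop 1 P
  · exact thinFibreAt_of_rootlessTop h2 hm
  exact thinFibreAt_of_levelFinite (levelFinite_of_siegelClause (hS P hP hd h1 h2)) m₀

/-- **THE UNIFORM THIN-FIBRE RESIDUAL `ThinFibre m₀` FOR EVERY `m₀ ≥ 2`, FROM `SiegelShapesOff` ALONE**
(the K-line's headline with the residual binder WEAKENED from `SiegelShapes` to `SiegelShapesOff`). -/
theorem thinFibre_of_siegelShapesOff (hS : SiegelShapesOff) {m₀ : ℕ} (hm : 2 ≤ m₀) : ThinFibre m₀ :=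
  thinFibre_of_prime hm (thinFibreAt_prime_of_siegelShapesOff hS hm)

/-- **THE (b)-CELL `AlgebraicIndependent ℚ ![ℓ₂, ρ]`, `ρ ∈ SkelFix m₀`, `m₀ ≥ 2`, FROM `SiegelShapesOff` ALONE.** -/
theorem b_of_siegelShapesOff (hS : SiegelShapesOff) {m₀ : ℕ} (hm : 2 ≤ m₀) (ρ : ℝ)
    (hρ : SkelLiouvilleFix m₀ ρ) : AlgebraicIndependent ℚ ![((liouvilleNumber 2 : ℝ) : ℂ), (ρ : ℂ)] :=
  thinFibre_imp_b (by omega) (thinFibre_of_siegelShapesOff hS hm) ρ hρ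

/-- **ITEM 31077 ON `(ℓ₂, ρ)`, `ρ ∈ SkelFix m₀`, `m₀ ≥ 2`, FROM `SiegelShapesOff` ALONE** (binders VERBATIM + one cell
line `Set.range z = Set.range ![ℓ₂, ρ]`). -/
theorem coordLiouvilleSchanuel_pair_of_siegelShapesOff (hS : SiegelShapesOff) {m₀ : ℕ} (hm : 2 ≤ m₀) {ρ : ℝ}
    (hρ : SkelLiouvilleFix m₀ ρ) :
    ∀ (n : ℕ) (z : Fin n → ℂ), LinearIndependent ℚ z →
      Set.range z = Set.range ![((liouvilleNumber 2 : ℝ) : ℂ), (ρ : ℂ)] →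
      (∃ w ∈ Submodule.span ℚ (Set.range z), Liouville w.re ∨ Liouville w.im) →
      (n : Cardinal) ≤ Algebra.trdeg ℚ
        ↥(IntermediateField.adjoin ℚ (Set.range z ∪ Set.range (Complex.exp ∘ z))) := by
  intro n z hz hrange _
  exact sb_of_range_eq' hz.injective hrange (sb_pair_of_algebraicIndependent (b_of_siegelShapesOff hS hm ρ hρ))

/-! ### §10.7  The residual at each quality `m₀`: Siegel's clause only OFF everything decided at `m₀` -/

/-- [class] definition (census convention): **decided at quality `m₀`** — the classes on which `ThinFibreAt m₀ P` is
PROVED hypothesis-free, in the tree BY NAME or in this node: low `Y`-degree (`thinFibreAt_of_natDegree_lt`), node 2's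
`XLinearLt` (`thinFibreAt_of_xLinearLt`), x-linear with separable `B` at `m₀ ≥ 3` (`thinFibreAt_xLinear_of_sep`),
the threshold class `thinThreshold P ≤ m₀` (`RootDecomp1KXAll.thinFibreAt_all`), and `RootlessTop (m₀ − 1)`
(`thinFibreAt_of_rootlessTop`). -/
def DecidedAt (m₀ : ℕ) (P : ℤ[X][X]) : Prop :=
  P.natDegree < m₀ ∨ XLinearLt P ∨
    (3 ≤ m₀ ∧ ∃ A B : ℤ[X], (B.map (Int.castRingHom ℚ)).Separable ∧ P = xLinP A B) ∨
    thinThreshold P ≤ m₀ ∨ RootlessTop (m₀ - 1) P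

/-- every class of `DecidedAt m₀` IS decided at `m₀` (`m₀ ≥ 2`, `P ≠ 0`). -/
theorem thinFibreAt_of_decidedAt {m₀ : ℕ} (hm : 2 ≤ m₀) {P : ℤ[X][X]} (hP0 : P ≠ 0) (h : DecidedAt m₀ P) :
    ThinFibreAt m₀ P := by
  rcases h with h | h | ⟨h3, A, B, hsep, rfl⟩ | h | h
  · exact thinFibreAt_of_natDegree_lt h
  · exact thinFibreAt_of_xLinearLt h hm
  · exact thinFibreAt_xLinear_of_sep A B hsep h3
  · exact thinFibreAt_all P hP0 h
  · exact thinFibreAt_of_rootlessTop h (by omega)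

/-- [residual statement def — NOT proved; census convention] **Siegel's clause OFF everything decided at quality
`m₀`.** -/
def SiegelShapesOffAt (m₀ : ℕ) : Prop :=
  ∀ P : ℤ[X][X], Prime P → 2 ≤ P.natDegree → ¬ DecidedAt m₀ P → SiegelClause P

/-- the weakenings, PROVED: `SiegelShapes → SiegelShapesOff → SiegelShapesOffAt m₀` (`m₀ ≥ 2`). -/
theorem siegelShapesOffAt_of_off (hS : SiegelShapesOff) {m₀ : ℕ} (hm : 2 ≤ m₀) : SiegelShapesOffAt m₀ := by
  intro P hP hd hnot
  refine hS P hP hd (fun h => hnot (Or.inr (Or.inl h))) fun h => hnot (Or.inr (Or.inr (Or.inr (Or.inr ?_))))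
  exact h.mono (by omega)

/-- **`ThinFibre m₀` FROM SIEGEL'S CLAUSE OFF THE CLASSES DECIDED AT `m₀`** (`m₀ ≥ 2`). -/
theorem thinFibre_of_siegelShapesOffAt {m₀ : ℕ} (hm : 2 ≤ m₀) (hS : SiegelShapesOffAt m₀) : ThinFibre m₀ := by
  refine thinFibre_of_prime hm fun P hP hd => ?_
  by_cases h : DecidedAt m₀ P
  · exact thinFibreAt_of_decidedAt hm hP.ne_zero h
  · exact thinFibreAt_of_levelFinite (levelFinite_of_siegelClause (hS P hP hd h)) m₀

/-- … and the (b)-cell from it. -/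
theorem b_of_siegelShapesOffAt {m₀ : ℕ} (hm : 2 ≤ m₀) (hS : SiegelShapesOffAt m₀) (ρ : ℝ)
    (hρ : SkelLiouvilleFix m₀ ρ) : AlgebraicIndependent ℚ ![((liouvilleNumber 2 : ℝ) : ℂ), (ρ : ℂ)] :=
  thinFibre_imp_b (by omega) (thinFibre_of_siegelShapesOffAt hm hS) ρ hρ

end RootlessTop

end Summit.Schanuel.Schanuel.Theorems.RootDecomp1KLevelFinite

end
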